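import Literature.NumberTheory.Automorphic.AlgebraicWeightHeckeCharacter
import Literature.Topology.Algebra.SubringClosureExtension
import Mathlib.Analysis.SpecificLimits.Basic
import HarnessLib

/-!
# Continuity of the Hecke character and its extension to `𝕋(K^p) → ℚ̄_p`

Topic `NumberTheory/Automorphic`; namespace `Literature.NumberTheory.Automorphic.AlgebraicWeight`.
Theorems only; no named fact, no instance, no `sorry`.

Given a tame level `𝒰`, values `a`, a degree `q`, and the **bound property**
`∀ s ∃ r ∀ Q, (Q(𝒰.heckeOperator tⱼ) = 0 in the factors (r, s, b), b ≤ q) ⇒ ‖Q(a)‖^{q+1} ≤ ‖p‖^s`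
(the output of `AlgebraicWeight.norm_pow_succ_le_of_heckeOperator_eq_zero`):

* `ker_of_bound` — `Q(T) = 0 ⇒ Q(a) = 0` (as `‖p‖ < 1`), so `x₀ = characterOfKer : ℤ[heckeGenerators] → ℚ̄_p`
  is defined;
* `continuous_characterOfKer_of_bound` — `x₀` is continuous for the topology induced from
  `∏_{(r,s,i)} End(Hⁱ(X_{U_r}, ℤ/p^s))` (basic neighbourhoods of `0` are "vanishing in finitely
  many factors");
* **`exists_continuous_ringHom_of_bound`** — if all the `Q(a)` lie in one finite extension
  `E/ℚ_p` inside `ℚ̄_p` (complete), `x₀` extends continuously to the closure `𝕋(K^p)`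
  (`Literature.Topology.Algebra.Subring.exists_continuous_extend_topologicalClosure`), giving
  `x : 𝕋(K^p) → ℚ̄_p` continuous with `x(T_{w,j}) = a_{w,j}` (`w ∉ S`, `1 ≤ j ≤ n`).

This is the topological half of [Scholze2015, Cor. V.4.2] ("continuous as it is continuous for
the finite ℤ_p-module H^i(X_K, 𝓜_{ξ,K})").

## References

* P. Scholze, *On torsion in the cohomology of locally symmetric varieties*, Ann. of Math. 182
  (2015), §V.4, Thm. V.4.1 and Cor. V.4.2. [Scholze2015]
-/

noncomputable section

open Filter Topology
open IsDedekindDomain NumberField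
open Literature.NumberTheory.Automorphic.BigHeckeGLn

namespace Literature.NumberTheory.Automorphic

namespace AlgebraicWeight

variable {n : ℕ} {K : Type} [Field K] [NumberField K] {p : ℕ} [Fact p.Prime] (𝒰 : TameLevel n K p)
  (a : HeightOneSpectrum (𝓞 K) → ℕ → PadicAlgCl p) (q : ℕ)

variable (hbd : ∀ s : ℕ, ∃ r : ℕ, ∀ Q : FreeRing (GenIndex 𝒰),
  (∀ b ≤ q, genPoly 𝒰 Q (r, s, b) = 0) →
    ‖FreeRing.lift (genValue 𝒰 a) Q‖ ^ (q + 1) ≤ ‖(p : PadicAlgCl p)‖ ^ s)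

include hbd in
/-- **`Q(T) = 0 ⇒ Q(a) = 0`** under the bound property (`‖Q(a)‖^{q+1} ≤ ‖p‖^s` for all `s`).
[cite: Scholze2015, §V.4 (proof of Cor. V.4.2)] -/
theorem ker_of_bound (Q : FreeRing (GenIndex 𝒰)) (hQ : genPoly 𝒰 Q = 0) :
    FreeRing.lift (genValue 𝒰 a) Q = 0 := by
  have hle : ∀ s : ℕ, ‖FreeRing.lift (genValue 𝒰 a) Q‖ ^ (q + 1) ≤ ‖(p : PadicAlgCl p)‖ ^ s := by
    intro s
    obtain ⟨r, hr⟩ := hbd s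
    exact hr Q fun b _ => by rw [hQ]; rfl
  -- `‖p‖ < 1` in `ℚ̄_p` (the tree's `PadicAlgCl.norm_natCast_p_lt_one`, whose module is a heavy import)
  have hp1 : ‖(p : PadicAlgCl p)‖ < 1 := by
    rw [← map_natCast (algebraMap ℚ_[p] (PadicAlgCl p)) p, PadicAlgCl.norm_extends]
    exact Padic.norm_p_lt_one
  have hlim : Tendsto (fun s : ℕ => ‖(p : PadicAlgCl p)‖ ^ s) atTop (𝓝 0) :=
    tendsto_pow_atTop_nhds_zero_of_lt_one (norm_nonneg _) hp1
  have h0 : ‖FreeRing.lift (genValue 𝒰 a) Q‖ ^ (q + 1) ≤ 0 :=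
    ge_of_tendsto' hlim hle
  have h1 : ‖FreeRing.lift (genValue 𝒰 a) Q‖ ^ (q + 1) = 0 :=
    le_antisymm h0 (pow_nonneg (norm_nonneg _) _)
  exact norm_eq_zero.1 (pow_eq_zero_iff (Nat.succ_ne_zero q) |>.1 h1)

/-- The basic neighbourhood "vanishing in the factors `(r, s, b)`, `b ≤ q`" is open in
`ℤ[heckeGenerators]`. [folklore] -/
theorem isOpen_vanishingSet (r s : ℕ) :
    IsOpen {T : Subring.closure 𝒰.heckeGenerators | ∀ b ≤ q, (T : 𝒰.bigEnd) (r, s, b) = 0} := by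
  have h : {T : Subring.closure 𝒰.heckeGenerators | ∀ b ≤ q, (T : 𝒰.bigEnd) (r, s, b) = 0} =
      ⋂ b ∈ Finset.range (q + 1),
        (fun T : Subring.closure 𝒰.heckeGenerators => (T : 𝒰.bigEnd) (r, s, b)) ⁻¹' {0} := by
    ext T
    simp
  rw [h]
  refine isOpen_biInter_finset fun b _ => ?_
  exact (isOpen_discrete _).preimage ((continuous_apply _).comp continuous_subtype_val)

include hbd in
/-- **`x₀` is continuous** under the bound property. [cite: Scholze2015, §V.4 (proof of Cor. V.4.2)] -/
theorem continuous_characterOfKer_of_bound :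
    Continuous (characterOfKer 𝒰 a (ker_of_bound 𝒰 a q hbd)) := by
  refine continuous_of_continuousAt_zero (characterOfKer 𝒰 a (ker_of_bound 𝒰 a q hbd)) ?_
  rw [ContinuousAt, map_zero, NormedAddGroup.tendsto_nhds_zero]
  intro ε hε
  have hp1 : ‖(p : PadicAlgCl p)‖ < 1 := by
    rw [← map_natCast (algebraMap ℚ_[p] (PadicAlgCl p)) p, PadicAlgCl.norm_extends]
    exact Padic.norm_p_lt_one
  -- choose `s` with `‖p‖^s < ε^{q+1}`, then `r`
  obtain ⟨s, hs⟩ := exists_pow_lt_of_lt_one (pow_pos hε (q + 1)) hp1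
  obtain ⟨r, hr⟩ := hbd s
  rw [Filter.eventually_iff_exists_mem]
  refine ⟨{T | ∀ b ≤ q, (T : 𝒰.bigEnd) (r, s, b) = 0},
    (isOpen_vanishingSet 𝒰 q r s).mem_nhds (fun b _ => rfl), fun T hT => ?_⟩
  obtain ⟨Q, hQ⟩ := exists_genPoly_eq_of_mem_closure 𝒰 T.2
  rw [characterOfKer_apply_of_eq 𝒰 a _ hQ]
  have hb : ‖FreeRing.lift (genValue 𝒰 a) Q‖ ^ (q + 1) < ε ^ (q + 1) :=
    lt_of_le_of_lt (hr Q fun b hb => by rw [hQ]; exact hT b hb) hs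
  exact lt_of_pow_lt_pow_left₀ _ hε.le hb

include hbd in
/-- **The continuous character `x : 𝕋(K^p) → ℚ̄_p` with `x(T_{w,j}) = a_{w,j}`** (`w ∉ S`,
`1 ≤ j ≤ n`), under the bound property and given a finite extension `E/ℚ_p` in `ℚ̄_p` containing
all the `Q(a)`: the continuous `x₀ : ℤ[heckeGenerators] → E` extends to the closure since `E` is
complete. [cite: Scholze2015, §V.4 (Cor. V.4.2)] -/
theorem exists_continuous_ringHom_of_bound (E : IntermediateField ℚ_[p] (PadicAlgCl p))
    [FiniteDimensional ℚ_[p] E] (hE : ∀ Q, FreeRing.lift (genValue 𝒰 a) Q ∈ E) :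
    ∃ x : CompletedCohomologyHeckeAlgebraGLn 𝒰 →+* PadicAlgCl p, Continuous x ∧
      ∀ w ∉ 𝒰.bad, ∀ j : ℕ, 1 ≤ j → j ≤ n → x (𝒰.heckeT w j) = a w j := by
  haveI : CompleteSpace E := FiniteDimensional.complete ℚ_[p] E
  -- `x₀` with values in `E`
  have hmem : ∀ T, characterOfKer 𝒰 a (ker_of_bound 𝒰 a q hbd) T ∈ E := fun T => by
    obtain ⟨Q, hQ⟩ := exists_genPoly_eq_of_mem_closure 𝒰 T.2
    rw [characterOfKer_apply_of_eq 𝒰 a _ hQ]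
    exact hE Q
  let f : Subring.closure 𝒰.heckeGenerators →+* E :=
    (characterOfKer 𝒰 a (ker_of_bound 𝒰 a q hbd)).codRestrict E.toSubalgebra.toSubring hmem
  have hf : Continuous f :=
    (continuous_characterOfKer_of_bound 𝒰 a q hbd).subtype_mk hmem
  obtain ⟨g, hgc, hg⟩ :=
    Literature.Topology.Algebra.Subring.exists_continuous_extend_topologicalClosure
      (Subring.closure 𝒰.heckeGenerators) f hf
  refine ⟨(algebraMap E (PadicAlgCl p)).comp g, continuous_subtype_val.comp hgc,
    fun w hw j h1 hn => ?_⟩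
  have hT : 𝒰.heckeT w j = Subring.inclusion (Subring.closure 𝒰.heckeGenerators).le_topologicalClosure
      ⟨𝒰.heckeOperator (heckeElement n K w j), Subring.subset_closure (Or.inl ⟨w, hw, j, rfl⟩)⟩ :=
    Subtype.ext (TameLevel.coe_heckeT 𝒰 hw j)
  have key : ((g (Subring.inclusion (Subring.closure 𝒰.heckeGenerators).le_topologicalClosure
      ⟨𝒰.heckeOperator (heckeElement n K w j), Subring.subset_closure (Or.inl ⟨w, hw, j, rfl⟩)⟩) : E) :
        PadicAlgCl p) = a w j := by
    rw [hg]
    exact characterOfKer_heckeOperator 𝒰 a _ hw h1 hn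
  change ((g (𝒰.heckeT w j) : E) : PadicAlgCl p) = a w j
  exact (congrArg (fun X => ((g X : E) : PadicAlgCl p)) hT).trans key

end AlgebraicWeight

end Literature.NumberTheory.Automorphic
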